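import Mathlib.Algebra.Homology.HomologySequenceLemmas
import Mathlib.Algebra.Homology.HomologicalComplexAbelian
import Mathlib.Algebra.Homology.HomologicalComplexBiprod
import Mathlib.Algebra.Homology.ShortComplex.ModuleCat
import Mathlib.Algebra.Category.ModuleCat.Abelian
import Mathlib.Algebra.Category.ModuleCat.Biproducts
import HarnessLib

/-!
# Homology classes, subcomplexes and quotient complexes of complexes of modules

Elementary homological algebra over `HomologicalComplex (ModuleCat R) c`, in the concrete
(element-level) form used by the singular-homology files of this directory
(A. Hatcher, *Algebraic Topology*, CUP 2002, §2.1: subcomplexes `C(A) ⊆ C(X)`, quotient complexes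
`C(X, A) = C(X)/C(A)`, the short exact sequence `0 → C(A) → C(X) → C(X, A) → 0`, and §2.2: the
short exact sequences `0 → C(A ∩ B) → C(A) ⊕ C(B) → C(A) + C(B) → 0` behind Mayer–Vietoris).

* `Literature.scHomologyCls S z hz`, `Literature.homologyCls K i z hz`: the homology class of a cycle, with
  surjectivity, the vanishing criterion (`z` is a boundary), naturality, and the elementwise
  criteria `isZero_homology_iff`, `homologyMap_injective_iff`, `homologyMap_surjective_iff`.
* `Literature.Subcomplex K`: a family of submodules stable under the differentials (a bounded lattice:
  `⊓`, `⊔`, `⊥`, `⊤`; `comap` along chain maps); the complex `S.toComplex`, the inclusion `S.ι` and co-restriction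
  `S.lift`, the quotient complex `S.quotient` with projection `S.π`, the short exact sequence
  `S.shortComplex`/`S.shortExact` (`0 → S → K → K/S → 0`), induced maps `subMap`/`incl` and
  `quotMap`/`quotientMap` with their functoriality, and `shortComplexMap`.
* Relative classes: `Subcomplex.relCls S x hx ∈ Hᵢ(K/S)` for a relative cycle `x` (`d x ∈ S`),
  with `relCls_surjective`, `relCls_eq_zero_iff` (`x` is a boundary modulo `S`), `relCls_sub`,
  `relCls_eq_relCls_iff`, and naturality `homologyMap_quotMap_relCls` /
  `homologyMap_quotientMap_relCls`.
* Excision algebra: the second-isomorphism map `Subcomplex.infQuotToSupQuot : T/(S ⊓ T) ⟶ (S ⊔ T)/S`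
  (an isomorphism, `isIso_infQuotToSupQuot`), and the quasi-isomorphism criteria
  `isIso_homologyMap_quotMap_ι` (`U/S ⟶ K/S` is a quasi-isomorphism when `U ↪ K` is, five lemma)
  and `isIso_homologyMap_quotMap_of_sup` (`T/(S ⊓ T) ⟶ K/S` when `S ⊔ T ↪ K` is).
* The two Mayer–Vietoris short exact sequences: `Subcomplex.mvSub S T`
  (`0 → S ⊓ T → S ⊞ T → S ⊔ T → 0`, `mvSub_shortExact`) and `Subcomplex.mvQuot S T`
  (`0 → K/(S ⊓ T) → K/S ⊞ K/T → K/(S ⊔ T) → 0`, `mvQuot_shortExact`).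
* Biproducts and homology: `isZero_homology_biprod`, `homology_biprod_ext`,
  `homologyMap_fst_homologyMap_lift`/`_snd_`, `homologyMap_lift_eq_zero_iff`.

Everything is a thin element-level layer over Mathlib's `ShortComplex`/`HomologicalComplex` API
(`ShortComplex.moduleCatCyclesIso`, `moduleCatHomologyIso`, `shortExact_of_degreewise_shortExact`,
`HomologicalComplex.HomologySequence`). [folklore]

Sign convention. The Mayer–Vietoris maps here are `x ↦ (x, x)` and `(y, z) ↦ y - z`, whereas
Hatcher (pp. 149–150) and `Literature.AlgebraicTopology.SingularHomology.mayerVietoris.φ`/`Literature.AlgebraicTopology.SingularHomology.mayerVietoris.ψ` in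
`ExcisionMayerVietoris.lean` use `x ↦ (x, -x)` and `(y, z) ↦ y + z`; the two short exact sequences
differ by the automorphism `-1` on the second summand `T` (resp. `K/T`), so any future comparison
with `Literature.mayerVietoris.φ/ψ` must insert that sign twist. Only exactness is used downstream.

## References

* A. Hatcher, *Algebraic Topology*, CUP 2002, §2.1–§2.2.
-/

noncomputable section

open CategoryTheory Limits

universe v w t

namespace Literature.AlgebraicTopology.SingularHomology

variable {R : Type v} [CommRing R]

/-! ### Homology classes of cycles: short complexes of modules -/

section ShortComplexClasses

variable (S : ShortComplex (ModuleCat.{w} R))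

variable {S} in
/-- The homology class `[z] ∈ H(S)` of a cycle `z ∈ S.X₂`, `S.g z = 0`, of a short complex of
`R`-modules (Hatcher 2002, §2.1, "`Ker ∂ / Im ∂`"): `homologyπ` of the cycle, through Mathlib's
`ShortComplex.moduleCatCyclesIso`. [folklore] -/
def scHomologyCls (z : S.X₂) (hz : S.g z = 0) : S.homology :=
  S.homologyπ (S.moduleCatCyclesIso.inv ⟨z, hz⟩)

variable {S}

/-- Under `H(S) ≅ ker g / im f` (Mathlib's `moduleCatHomologyIso`), `[z]` is the residue class of
`z` (Hatcher 2002, §2.1). [folklore] -/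
lemma moduleCatHomologyIso_hom_scHomologyCls (z : S.X₂) (hz : S.g z = 0) :
    S.moduleCatHomologyIso.hom (scHomologyCls z hz) =
      Submodule.Quotient.mk (⟨z, hz⟩ : LinearMap.ker S.g.hom) := by
  rw [scHomologyCls, ShortComplex.π_moduleCatCyclesIso_hom_apply, Iso.inv_hom_id_apply]
  rfl

/-- `z ↦ [z]` is the restriction of an `R`-linear map (Hatcher 2002, §2.1). [folklore] -/
lemma scHomologyCls_eq_hom (z : S.X₂) (hz : S.g z = 0) :
    scHomologyCls z hz = (S.moduleCatCyclesIso.inv ≫ S.homologyπ).hom ⟨z, hz⟩ := rfl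

/-- `[z + z'] = [z] + [z']` (Hatcher 2002, §2.1). [folklore] -/
lemma scHomologyCls_add (z z' : S.X₂) (hz : S.g z = 0) (hz' : S.g z' = 0)
    (h : S.g (z + z') = 0) :
    scHomologyCls (z + z') h = scHomologyCls z hz + scHomologyCls z' hz' := by
  simp only [scHomologyCls_eq_hom, ← map_add]
  rfl

/-- `[z - z'] = [z] - [z']` (Hatcher 2002, §2.1). [folklore] -/
lemma scHomologyCls_sub (z z' : S.X₂) (hz : S.g z = 0) (hz' : S.g z' = 0)
    (h : S.g (z - z') = 0) :
    scHomologyCls (z - z') h = scHomologyCls z hz - scHomologyCls z' hz' := by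
  simp only [scHomologyCls_eq_hom, ← map_sub]
  rfl

/-- `[r • z] = r • [z]` (Hatcher 2002, §2.1). [folklore] -/
lemma scHomologyCls_smul (r : R) (z : S.X₂) (hz : S.g z = 0) (h : S.g (r • z) = 0) :
    scHomologyCls (r • z) h = r • scHomologyCls z hz := by
  simp only [scHomologyCls_eq_hom, ← map_smul]
  rfl

/-- `[0] = 0` (Hatcher 2002, §2.1). [folklore] -/
lemma scHomologyCls_zero (h : S.g 0 = 0) : scHomologyCls (0 : S.X₂) h = 0 := by
  rw [scHomologyCls_eq_hom]
  exact (S.moduleCatCyclesIso.inv ≫ S.homologyπ).hom.map_zero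

/-- Every homology class is the class of a cycle (Hatcher 2002, §2.1). [folklore] -/
lemma scHomologyCls_surjective (x : S.homology) :
    ∃ (z : S.X₂) (hz : S.g z = 0), scHomologyCls z hz = x := by
  obtain ⟨q, hq⟩ := (ModuleCat.epi_iff_surjective _).mp
    (inferInstance : Epi S.moduleCatHomologyIso.inv) x
  obtain ⟨⟨z, hz⟩, rfl⟩ := Submodule.mkQ_surjective _ q
  refine ⟨z, hz, ?_⟩
  rw [← hq]
  apply (ModuleCat.mono_iff_injective S.moduleCatHomologyIso.hom).mp inferInstance
  rw [moduleCatHomologyIso_hom_scHomologyCls, ← ModuleCat.comp_apply, Iso.inv_hom_id,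
    ModuleCat.id_apply]
  rfl

/-- `[z] = 0` iff `z` is a boundary (Hatcher 2002, §2.1). [folklore] -/
lemma scHomologyCls_eq_zero_iff (z : S.X₂) (hz : S.g z = 0) :
    scHomologyCls z hz = 0 ↔ ∃ w : S.X₁, S.f w = z := by
  have key : scHomologyCls z hz = 0 ↔
      Submodule.Quotient.mk (p := LinearMap.range S.moduleCatToCycles)
        (⟨z, hz⟩ : LinearMap.ker S.g.hom) = 0 := by
    rw [← moduleCatHomologyIso_hom_scHomologyCls]
    constructor
    · intro h
      rw [h, map_zero]
      rfl
    · intro h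
      apply (ModuleCat.mono_iff_injective S.moduleCatHomologyIso.hom).mp inferInstance
      rw [h, map_zero]
      rfl
  rw [key, Submodule.Quotient.mk_eq_zero, LinearMap.mem_range]
  constructor
  · rintro ⟨w, hw⟩
    exact ⟨w, congrArg Subtype.val hw⟩
  · rintro ⟨w, hw⟩
    exact ⟨w, Subtype.ext hw⟩

/-- Naturality of `[z]` for morphisms of short complexes (Hatcher 2002, §2.1). [folklore] -/
lemma homologyMap_scHomologyCls {S' : ShortComplex (ModuleCat.{w} R)} (φ : S ⟶ S') (z : S.X₂)
    (hz : S.g z = 0) (h' : S'.g (φ.τ₂ z) = 0) :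
    ShortComplex.homologyMap φ (scHomologyCls z hz) = scHomologyCls (φ.τ₂ z) h' := by
  have hcyc : ShortComplex.cyclesMap φ (S.moduleCatCyclesIso.inv ⟨z, hz⟩) =
      S'.moduleCatCyclesIso.inv ⟨φ.τ₂ z, h'⟩ := by
    apply (ModuleCat.mono_iff_injective S'.iCycles).mp inferInstance
    rw [← ModuleCat.comp_apply, ShortComplex.cyclesMap_i, ModuleCat.comp_apply,
      ShortComplex.moduleCatCyclesIso_inv_iCycles_apply,
      ShortComplex.moduleCatCyclesIso_inv_iCycles_apply]
    rfl
  rw [scHomologyCls, ← ModuleCat.comp_apply, ShortComplex.homologyπ_naturality,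
    ModuleCat.comp_apply, hcyc]
  rfl

end ShortComplexClasses

/-! ### Homology classes of cycles: homological complexes of modules -/

section HomologyClasses

variable {ι : Type t} {c : ComplexShape ι}
variable {K L : HomologicalComplex (ModuleCat.{w} R) c} {i : ι}

/-- The homology class `[z] ∈ Hᵢ(K)` of a cycle `z ∈ Kᵢ`, `d z = 0` (Hatcher 2002, §2.1);
`scHomologyCls` for the short complex `K.sc i`. [folklore] -/
def homologyCls (z : K.X i) (hz : K.d i (c.next i) z = 0) : K.homology i :=
  scHomologyCls (S := K.sc i) z hz

/-- `[z + z'] = [z] + [z']` (Hatcher 2002, §2.1). [folklore] -/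
lemma homologyCls_add (z z' : K.X i) (hz : K.d i (c.next i) z = 0)
    (hz' : K.d i (c.next i) z' = 0) (h : K.d i (c.next i) (z + z') = 0) :
    homologyCls (z + z') h = homologyCls z hz + homologyCls z' hz' :=
  scHomologyCls_add (S := K.sc i) z z' hz hz' h

/-- `[z - z'] = [z] - [z']` (Hatcher 2002, §2.1). [folklore] -/
lemma homologyCls_sub (z z' : K.X i) (hz : K.d i (c.next i) z = 0)
    (hz' : K.d i (c.next i) z' = 0) (h : K.d i (c.next i) (z - z') = 0) :
    homologyCls (z - z') h = homologyCls z hz - homologyCls z' hz' :=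
  scHomologyCls_sub (S := K.sc i) z z' hz hz' h

/-- `[r • z] = r • [z]` (Hatcher 2002, §2.1). [folklore] -/
lemma homologyCls_smul (r : R) (z : K.X i) (hz : K.d i (c.next i) z = 0)
    (h : K.d i (c.next i) (r • z) = 0) :
    homologyCls (r • z) h = r • homologyCls z hz :=
  scHomologyCls_smul (S := K.sc i) r z hz h

/-- `[0] = 0` (Hatcher 2002, §2.1). [folklore] -/
lemma homologyCls_zero (h : K.d i (c.next i) 0 = 0) : homologyCls (0 : K.X i) h = 0 :=
  scHomologyCls_zero (S := K.sc i) h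

/-- The class `[z]` only depends on `z` (Hatcher 2002, §2.1). [folklore] -/
lemma homologyCls_congr {z z' : K.X i} (e : z = z') (hz : K.d i (c.next i) z = 0)
    (hz' : K.d i (c.next i) z' = 0) : homologyCls z hz = homologyCls z' hz' := by
  subst e
  rfl

/-- Every homology class is the class of a cycle (Hatcher 2002, §2.1). [folklore] -/
lemma homologyCls_surjective (x : K.homology i) :
    ∃ (z : K.X i) (hz : K.d i (c.next i) z = 0), homologyCls z hz = x :=
  scHomologyCls_surjective (S := K.sc i) x

/-- `[z] = 0` iff `z` is a boundary (Hatcher 2002, §2.1). [folklore] -/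
lemma homologyCls_eq_zero_iff (z : K.X i) (hz : K.d i (c.next i) z = 0) :
    homologyCls z hz = 0 ↔ ∃ w : K.X (c.prev i), K.d (c.prev i) i w = z :=
  scHomologyCls_eq_zero_iff (S := K.sc i) z hz

/-- Two cycles have the same class iff they differ by a boundary (Hatcher 2002, §2.1). [folklore] -/
lemma homologyCls_eq_homologyCls_iff (z z' : K.X i) (hz : K.d i (c.next i) z = 0)
    (hz' : K.d i (c.next i) z' = 0) :
    homologyCls z hz = homologyCls z' hz' ↔
      ∃ w : K.X (c.prev i), K.d (c.prev i) i w = z - z' := by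
  rw [← sub_eq_zero, ← homologyCls_sub z z' hz hz' (by rw [map_sub, hz, hz', sub_zero]),
    homologyCls_eq_zero_iff]

/-- A chain map sends cycles to cycles (Hatcher 2002, §2.1). [folklore] -/
lemma d_hom_f_eq_zero (φ : K ⟶ L) (z : K.X i) (hz : K.d i (c.next i) z = 0) :
    L.d i (c.next i) (φ.f i z) = 0 := by
  rw [← ModuleCat.comp_apply, φ.comm, ModuleCat.comp_apply, hz, map_zero]

/-- Naturality: a chain map sends `[z]` to `[φ z]` (Hatcher 2002, §2.1, Prop. 2.9 ff.). [folklore] -/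
lemma homologyMap_homologyCls (φ : K ⟶ L) (z : K.X i) (hz : K.d i (c.next i) z = 0) :
    HomologicalComplex.homologyMap φ i (homologyCls z hz) =
      homologyCls (φ.f i z) (d_hom_f_eq_zero φ z hz) :=
  homologyMap_scHomologyCls ((HomologicalComplex.shortComplexFunctor _ c i).map φ) z hz _

variable (K i) in
/-- `Hᵢ(K) = 0` iff every `i`-cycle is a boundary (Hatcher 2002, §2.1). [folklore] -/
lemma isZero_homology_iff :
    IsZero (K.homology i) ↔
      ∀ (z : K.X i), K.d i (c.next i) z = 0 → ∃ w : K.X (c.prev i), K.d (c.prev i) i w = z := by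
  constructor
  · intro h z hz
    haveI := ModuleCat.subsingleton_of_isZero h
    exact (homologyCls_eq_zero_iff z hz).mp (Subsingleton.elim _ _)
  · intro h
    haveI : Subsingleton (K.homology i) := ⟨fun x y => by
      obtain ⟨z, hz, rfl⟩ := homologyCls_surjective x
      obtain ⟨z', hz', rfl⟩ := homologyCls_surjective y
      rw [homologyCls_eq_homologyCls_iff]
      obtain ⟨w, hw⟩ := h z hz
      obtain ⟨w', hw'⟩ := h z' hz'
      exact ⟨w - w', by rw [map_sub, hw, hw']⟩⟩
    exact ModuleCat.isZero_of_subsingleton _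

/-- A map on homology is injective iff cycles mapping to boundaries are boundaries
(Hatcher 2002, §2.1). [folklore] -/
lemma homologyMap_injective_iff (φ : K ⟶ L) :
    Function.Injective (HomologicalComplex.homologyMap φ i) ↔
      ∀ (z : K.X i), K.d i (c.next i) z = 0 →
        (∃ w : L.X (c.prev i), L.d (c.prev i) i w = φ.f i z) →
          ∃ w : K.X (c.prev i), K.d (c.prev i) i w = z := by
  rw [injective_iff_map_eq_zero]
  constructor
  · intro h z hz hb
    refine (homologyCls_eq_zero_iff z hz).mp (h _ ?_)
    rw [homologyMap_homologyCls, homologyCls_eq_zero_iff]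
    exact hb
  · intro h x hx
    obtain ⟨z, hz, rfl⟩ := homologyCls_surjective x
    rw [homologyMap_homologyCls, homologyCls_eq_zero_iff] at hx
    exact (homologyCls_eq_zero_iff z hz).mpr (h z hz hx)

/-- A map on homology is surjective iff every cycle of the target is homologous to the image of a
cycle of the source (Hatcher 2002, §2.1). [folklore] -/
lemma homologyMap_surjective_iff (φ : K ⟶ L) :
    Function.Surjective (HomologicalComplex.homologyMap φ i) ↔
      ∀ (z : L.X i), L.d i (c.next i) z = 0 →
        ∃ (y : K.X i) (_ : K.d i (c.next i) y = 0) (w : L.X (c.prev i)),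
          L.d (c.prev i) i w = z - φ.f i y := by
  constructor
  · intro h z hz
    obtain ⟨x, hx⟩ := h (homologyCls z hz)
    obtain ⟨y, hy, rfl⟩ := homologyCls_surjective x
    rw [homologyMap_homologyCls, homologyCls_eq_homologyCls_iff] at hx
    obtain ⟨w, hw⟩ := hx
    exact ⟨y, hy, -w, by rw [map_neg, hw, neg_sub]⟩
  · intro h x
    obtain ⟨z, hz, rfl⟩ := homologyCls_surjective x
    obtain ⟨y, hy, w, hw⟩ := h z hz
    refine ⟨homologyCls y hy, ?_⟩
    rw [homologyMap_homologyCls, homologyCls_eq_homologyCls_iff]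
    exact ⟨-w, by rw [map_neg, hw, neg_sub]⟩

end HomologyClasses

/-! ### Homology of binary biproducts of complexes -/

section Biprod

variable {β : Type t} {c : ComplexShape β}
variable (A B : HomologicalComplex (ModuleCat.{w} R) c) (i : β)

/-- `y = inl (fst y) + inr (snd y)` in a binary biproduct of complexes of modules, degreewise. [folklore] -/
lemma biprod_decomp {A B : HomologicalComplex (ModuleCat.{w} R) c} (i : β) (y : (A ⊞ B).X i) :
    (biprod.inl : A ⟶ A ⊞ B).f i ((biprod.fst : A ⊞ B ⟶ A).f i y) +
      (biprod.inr : B ⟶ A ⊞ B).f i ((biprod.snd : A ⊞ B ⟶ B).f i y) = y := by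
  have htot := congrArg (fun φ : (A ⊞ B).X i ⟶ (A ⊞ B).X i => φ y)
    (HomologicalComplex.biprod_total_f A B i)
  simpa only [ModuleCat.hom_add, LinearMap.add_apply, ModuleCat.comp_apply,
    HomologicalComplex.id_f, ModuleCat.id_apply] using htot

/-- An element of `Hᵢ(A ⊞ B)` with vanishing projections to `Hᵢ(A)` and `Hᵢ(B)` is zero
(additivity of homology; Hatcher 2002, §2.2, `Hₙ(A ⊕ B) = Hₙ(A) ⊕ Hₙ(B)`). [folklore] -/
lemma homology_biprod_ext (x : (A ⊞ B).homology i)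
    (h₁ : HomologicalComplex.homologyMap (biprod.fst : A ⊞ B ⟶ A) i x = 0)
    (h₂ : HomologicalComplex.homologyMap (biprod.snd : A ⊞ B ⟶ B) i x = 0) : x = 0 := by
  have htot := congrArg (fun φ : A ⊞ B ⟶ A ⊞ B => HomologicalComplex.homologyMap φ i x)
    (biprod.total : _ = 𝟙 (A ⊞ B))
  simp only [HomologicalComplex.homologyMap_id, ModuleCat.id_apply,
    HomologicalComplex.homologyMap_add, HomologicalComplex.homologyMap_comp, ModuleCat.hom_add,
    LinearMap.add_apply, ModuleCat.comp_apply] at htot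
  rw [h₁, h₂, map_zero, map_zero, add_zero] at htot
  exact htot.symm

/-- `Hᵢ(A ⊞ B) = 0` when `Hᵢ(A) = 0` and `Hᵢ(B) = 0` (Hatcher 2002, §2.2). [folklore] -/
lemma isZero_homology_biprod (hA : IsZero (A.homology i)) (hB : IsZero (B.homology i)) :
    IsZero ((A ⊞ B).homology i) := by
  haveI := ModuleCat.subsingleton_of_isZero hA
  haveI := ModuleCat.subsingleton_of_isZero hB
  haveI : Subsingleton ((A ⊞ B).homology i) := ⟨fun x y => by
    rw [← sub_eq_zero]
    exact homology_biprod_ext A B i _ (Subsingleton.elim _ _) (Subsingleton.elim _ _)⟩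
  exact ModuleCat.isZero_of_subsingleton _

variable {A B i}

/-- The `Hᵢ(A)`-component of `Hᵢ(lift u v) x` is `Hᵢ(u) x` (Hatcher 2002, §2.2). [folklore] -/
lemma homologyMap_fst_homologyMap_lift {M : HomologicalComplex (ModuleCat.{w} R) c}
    (u : M ⟶ A) (v : M ⟶ B) (x : M.homology i) :
    HomologicalComplex.homologyMap (biprod.fst : A ⊞ B ⟶ A) i
        (HomologicalComplex.homologyMap (biprod.lift u v) i x) =
      HomologicalComplex.homologyMap u i x := by
  rw [← ModuleCat.comp_apply, ← HomologicalComplex.homologyMap_comp, biprod.lift_fst]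

/-- The `Hᵢ(B)`-component of `Hᵢ(lift u v) x` is `Hᵢ(v) x` (Hatcher 2002, §2.2). [folklore] -/
lemma homologyMap_snd_homologyMap_lift {M : HomologicalComplex (ModuleCat.{w} R) c}
    (u : M ⟶ A) (v : M ⟶ B) (x : M.homology i) :
    HomologicalComplex.homologyMap (biprod.snd : A ⊞ B ⟶ B) i
        (HomologicalComplex.homologyMap (biprod.lift u v) i x) =
      HomologicalComplex.homologyMap v i x := by
  rw [← ModuleCat.comp_apply, ← HomologicalComplex.homologyMap_comp, biprod.lift_snd]

/-- `Hᵢ(lift u v) x = 0` iff `Hᵢ(u) x = 0` and `Hᵢ(v) x = 0` (Hatcher 2002, §2.2). [folklore] -/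
lemma homologyMap_lift_eq_zero_iff {M : HomologicalComplex (ModuleCat.{w} R) c}
    (u : M ⟶ A) (v : M ⟶ B) (x : M.homology i) :
    HomologicalComplex.homologyMap (biprod.lift u v) i x = 0 ↔
      HomologicalComplex.homologyMap u i x = 0 ∧ HomologicalComplex.homologyMap v i x = 0 := by
  constructor
  · intro h
    rw [← homologyMap_fst_homologyMap_lift u v x, ← homologyMap_snd_homologyMap_lift u v x, h,
      map_zero, map_zero]
    exact ⟨rfl, rfl⟩
  · rintro ⟨hu, hv⟩
    exact homology_biprod_ext A B i _ (by rw [homologyMap_fst_homologyMap_lift, hu])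
      (by rw [homologyMap_snd_homologyMap_lift, hv])

end Biprod

/-! ### Subcomplexes -/

section Subcomplexes

variable {β : Type t} {c : ComplexShape β}

/-- A subcomplex of a complex of `R`-modules: a family of submodules `Sᵢ ⊆ Kᵢ` with
`d(Sᵢ) ⊆ Sⱼ` (Hatcher 2002, §2.1: e.g. `C(A) ⊆ C(X)`, or the `𝒰`-small chains `C^𝒰(X)` of
Prop. 2.21). [folklore] -/
structure Subcomplex (K : HomologicalComplex (ModuleCat.{w} R) c) where
  /-- the submodule of `i`-chains belonging to the subcomplex -/
  carrier : (i : β) → Submodule R (K.X i)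
  /-- the differentials preserve the subcomplex -/
  d_mem' : ∀ {i j : β} {x : K.X i}, x ∈ carrier i → K.d i j x ∈ carrier j

namespace Subcomplex

variable {K L N : HomologicalComplex (ModuleCat.{w} R) c}

/-- Apply a subcomplex to a degree to get its submodule of chains. [folklore] -/
instance : CoeFun (Subcomplex K) (fun _ => (i : β) → Submodule R (K.X i)) := ⟨carrier⟩

/-- `d` maps `Sᵢ` into `Sⱼ` (Hatcher 2002, §2.1). [folklore] -/
lemma d_mem (S : Subcomplex K) {i j : β} {x : K.X i} (hx : x ∈ S i) : K.d i j x ∈ S j :=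
  S.d_mem' hx

/-- Two subcomplexes with the same submodules are equal. [folklore] -/
@[ext]
lemma ext {S T : Subcomplex K} (h : ∀ i, S i = T i) : S = T := by
  cases S; cases T
  congr
  exact funext h

/-- `carrier` is injective. [folklore] -/
lemma carrier_injective :
    Function.Injective (carrier : Subcomplex K → (i : β) → Submodule R (K.X i)) :=
  fun _ _ h => ext (fun i => congrFun h i)

/-- The intersection of two subcomplexes (Hatcher 2002, §2.2: `C(A ∩ B) = C(A) ∩ C(B)`). [folklore] -/
protected def inf (S T : Subcomplex K) : Subcomplex K where
  carrier i := S i ⊓ T i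
  d_mem' hx := ⟨S.d_mem hx.1, T.d_mem hx.2⟩

/-- The sum of two subcomplexes (Hatcher 2002, §2.2: `C(A) + C(B)`). [folklore] -/
protected def sup (S T : Subcomplex K) : Subcomplex K where
  carrier i := S i ⊔ T i
  d_mem' {i j x} hx := by
    obtain ⟨y, hy, z, hz, rfl⟩ := Submodule.mem_sup.mp hx
    rw [map_add]
    exact Submodule.add_mem_sup (S.d_mem hy) (T.d_mem hz)

/-- The whole complex as a subcomplex. [folklore] -/
protected def top : Subcomplex K where
  carrier _ := ⊤
  d_mem' _ := trivial

/-- The zero subcomplex. [folklore] -/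
protected def bot : Subcomplex K where
  carrier _ := ⊥
  d_mem' {i j x} hx := by
    rw [(Submodule.mem_bot R).mp hx, map_zero]
    exact Submodule.zero_mem _

/-- `S ⊔ T`, the sum of subcomplexes. [folklore] -/
instance : Max (Subcomplex K) := ⟨Subcomplex.sup⟩
/-- `S ⊓ T`, the intersection of subcomplexes. [folklore] -/
instance : Min (Subcomplex K) := ⟨Subcomplex.inf⟩
/-- `⊤`, the whole complex as a subcomplex. [folklore] -/
instance : Top (Subcomplex K) := ⟨Subcomplex.top⟩
/-- `⊥`, the zero subcomplex. [folklore] -/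
instance : Bot (Subcomplex K) := ⟨Subcomplex.bot⟩
/-- Degreewise inclusion of subcomplexes. [folklore] -/
instance : LE (Subcomplex K) := ⟨fun S T => S.carrier ≤ T.carrier⟩
/-- Strict degreewise inclusion of subcomplexes. [folklore] -/
instance : LT (Subcomplex K) := ⟨fun S T => S.carrier < T.carrier⟩

/-- Subcomplexes form a lattice under degreewise inclusion (Hatcher 2002, §2.2). [folklore] -/
instance : Lattice (Subcomplex K) :=
  Function.Injective.lattice carrier carrier_injective Iff.rfl Iff.rfl (fun _ _ => rfl)
    (fun _ _ => rfl)

/-- `⊤` is the largest subcomplex. [folklore] -/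
instance : OrderTop (Subcomplex K) where
  le_top _ _ := le_top

/-- `⊥` is the least subcomplex. [folklore] -/
instance : OrderBot (Subcomplex K) where
  bot_le _ _ := bot_le

/-- `S ≤ T` iff `Sᵢ ⊆ Tᵢ` for all `i`. [folklore] -/
lemma le_def {S T : Subcomplex K} : S ≤ T ↔ ∀ i, S i ≤ T i := Iff.rfl

/-- `(S ⊔ T)ᵢ = Sᵢ ⊔ Tᵢ`. [folklore] -/
@[simp] lemma sup_apply (S T : Subcomplex K) (i : β) : (S ⊔ T) i = S i ⊔ T i := rfl

/-- `(S ⊓ T)ᵢ = Sᵢ ⊓ Tᵢ`. [folklore] -/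
@[simp] lemma inf_apply (S T : Subcomplex K) (i : β) : (S ⊓ T) i = S i ⊓ T i := rfl

/-- `⊤ᵢ = ⊤`. [folklore] -/
@[simp] lemma top_apply (i : β) : (⊤ : Subcomplex K) i = ⊤ := rfl

/-- `⊥ᵢ = ⊥`. [folklore] -/
@[simp] lemma bot_apply (i : β) : (⊥ : Subcomplex K) i = ⊥ := rfl

/-- The pull-back of a subcomplex along a chain map (e.g. `C(A) ∩ C(B)` viewed inside `C(B)`)
(Hatcher 2002, §2.1). [folklore] -/
def comap (f : K ⟶ L) (T : Subcomplex L) : Subcomplex K where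
  carrier i := (T i).comap (f.f i).hom
  d_mem' {i j x} hx := by
    change f.f j (K.d i j x) ∈ T j
    rw [← ModuleCat.comp_apply, ← f.comm, ModuleCat.comp_apply]
    exact T.d_mem hx

/-- Membership in a pulled-back subcomplex. [folklore] -/
@[simp] lemma mem_comap {f : K ⟶ L} {T : Subcomplex L} {i : β} {x : K.X i} :
    x ∈ T.comap f i ↔ f.f i x ∈ T i := Iff.rfl

/-- Pull-back of subcomplexes is functorial. [folklore] -/
lemma comap_comp (f : K ⟶ L) (g : L ⟶ N) (U : Subcomplex N) :
    U.comap (f ≫ g) = (U.comap g).comap f := rfl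

/-! #### The complex of a subcomplex and its inclusion -/

/-- The subcomplex as a complex in its own right (Hatcher 2002, §2.1). [folklore] -/
def toComplex (S : Subcomplex K) : HomologicalComplex (ModuleCat.{w} R) c where
  X i := ModuleCat.of R (S i)
  d i j := ModuleCat.ofHom ((K.d i j).hom.restrict (fun _ hx => S.d_mem hx))
  shape i j hij := by
    ext x
    change K.d i j x.1 = 0
    rw [K.shape i j hij]
    rfl
  d_comp_d' i j k _ _ := by
    ext x
    change K.d j k (K.d i j x.1) = 0
    rw [← ModuleCat.comp_apply, K.d_comp_d]
    rfl

/-- The differential of `S.toComplex` is the restriction of that of `K`. [folklore] -/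
lemma toComplex_d_apply_val (S : Subcomplex K) (i j : β) (x : S.toComplex.X i) :
    (S.toComplex.d i j x).1 = K.d i j x.1 := rfl

/-- The inclusion chain map `S ↪ K` (Hatcher 2002, §2.1). [folklore] -/
def ι (S : Subcomplex K) : S.toComplex ⟶ K where
  f i := ModuleCat.ofHom (S i).subtype
  comm' _ _ _ := rfl

/-- The inclusion `S ↪ K` is the subtype map in each degree. [folklore] -/
lemma ι_f_apply (S : Subcomplex K) (i : β) (x : S.toComplex.X i) : S.ι.f i x = x.1 := rfl

/-- The inclusion is injective in each degree. [folklore] -/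
lemma ι_f_injective (S : Subcomplex K) (i : β) : Function.Injective (S.ι.f i) :=
  Subtype.val_injective

/-- Elements of `S.toComplex` lie in `S`. [folklore] -/
lemma ι_f_mem (S : Subcomplex K) (i : β) (x : S.toComplex.X i) : S.ι.f i x ∈ S i := x.2

/-- The inclusion of a subcomplex is a monomorphism of complexes. [folklore] -/
instance (S : Subcomplex K) : Mono S.ι :=
  HomologicalComplex.mono_of_mono_f _ (fun i => (ModuleCat.mono_iff_injective _).mpr
    (S.ι_f_injective i))

/-- The chain map into a subcomplex obtained from a chain map landing in it (co-restriction)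
(Hatcher 2002, §2.1). [folklore] -/
def lift (S : Subcomplex K) (f : L ⟶ K) (hf : ∀ i (x : L.X i), f.f i x ∈ S i) :
    L ⟶ S.toComplex where
  f i := ModuleCat.ofHom ((f.f i).hom.codRestrict (S i) (hf i))
  comm' i j _ := by
    ext x
    apply Subtype.ext
    change K.d i j (f.f i x) = f.f j (L.d i j x)
    rw [← ModuleCat.comp_apply, f.comm, ModuleCat.comp_apply]

/-- The co-restriction has the prescribed underlying values. [folklore] -/
lemma lift_f_apply_val (S : Subcomplex K) (f : L ⟶ K) (hf : ∀ i (x : L.X i), f.f i x ∈ S i)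
    (i : β) (x : L.X i) : ((S.lift f hf).f i x).1 = f.f i x := rfl

/-- The co-restriction followed by the inclusion is the original map. [folklore] -/
@[reassoc (attr := simp)]
lemma lift_ι (S : Subcomplex K) (f : L ⟶ K) (hf : ∀ i (x : L.X i), f.f i x ∈ S i) :
    S.lift f hf ≫ S.ι = f := rfl

/-- A co-restriction is an isomorphism of complexes when `f` is injective with image exactly `S`. [folklore] -/
lemma isIso_lift (S : Subcomplex K) (f : L ⟶ K) (hf : ∀ i (x : L.X i), f.f i x ∈ S i)
    (hinj : ∀ i, Function.Injective (f.f i))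
    (hsurj : ∀ i (y : K.X i), y ∈ S i → ∃ x, f.f i x = y) :
    IsIso (S.lift f hf) := by
  haveI : ∀ i, IsIso ((S.lift f hf).f i) := fun i => by
    rw [ConcreteCategory.isIso_iff_bijective]
    refine ⟨fun x y hxy => hinj i ?_, fun y => ?_⟩
    · have h := congrArg Subtype.val hxy
      exact h
    · obtain ⟨x, hx⟩ := hsurj i y.1 y.2
      exact ⟨x, Subtype.ext hx⟩
  exact HomologicalComplex.Hom.isIso_of_components _

/-- The chain map between subcomplexes induced by a chain map `f : K ⟶ L` with `f(S) ⊆ T`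
(Hatcher 2002, §2.1, maps of pairs). [folklore] -/
def subMap (f : K ⟶ L) (S : Subcomplex K) (T : Subcomplex L) (hf : S ≤ T.comap f) :
    S.toComplex ⟶ T.toComplex :=
  T.lift (S.ι ≫ f) (fun i x => hf i x.2)

/-- Underlying values of the induced map of subcomplexes. [folklore] -/
lemma subMap_f_apply_val (f : K ⟶ L) (S : Subcomplex K) (T : Subcomplex L)
    (hf : S ≤ T.comap f) (i : β) (x : S.toComplex.X i) :
    ((subMap f S T hf).f i x).1 = f.f i x.1 := rfl

/-- The induced map of subcomplexes commutes with the inclusions. [folklore] -/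
@[reassoc (attr := simp)]
lemma subMap_ι (f : K ⟶ L) (S : Subcomplex K) (T : Subcomplex L) (hf : S ≤ T.comap f) :
    subMap f S T hf ≫ T.ι = S.ι ≫ f := rfl

/-- The map of subcomplexes induced by the identity is the identity. [folklore] -/
lemma subMap_id (S : Subcomplex K) (h : S ≤ S.comap (𝟙 K)) : subMap (𝟙 K) S S h = 𝟙 _ := by
  ext i x
  rfl

/-- The map of subcomplexes induced by a composite is the composite. [folklore] -/
lemma subMap_comp (f : K ⟶ L) (g : L ⟶ N) (S : Subcomplex K) (T : Subcomplex L)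
    (U : Subcomplex N) (hf : S ≤ T.comap f) (hg : T ≤ U.comap g) (hfg : S ≤ U.comap (f ≫ g)) :
    subMap (f ≫ g) S U hfg = subMap f S T hf ≫ subMap g T U hg := by
  ext i x
  rfl

/-- The induced map of subcomplexes only depends on the chain map. [folklore] -/
lemma subMap_congr {f g : K ⟶ L} (h : f = g) (S : Subcomplex K) (T : Subcomplex L)
    (hf : S ≤ T.comap f) (hg : S ≤ T.comap g) : subMap f S T hf = subMap g S T hg := by
  subst h
  rfl

/-- The inclusion of nested subcomplexes `S ≤ T` (Hatcher 2002, §2.1). [folklore] -/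
def incl {S T : Subcomplex K} (h : S ≤ T) : S.toComplex ⟶ T.toComplex :=
  subMap (𝟙 K) S T h

/-- Underlying values are unchanged by the inclusion of nested subcomplexes. [folklore] -/
lemma incl_f_apply_val {S T : Subcomplex K} (h : S ≤ T) (i : β) (x : S.toComplex.X i) :
    ((incl h).f i x).1 = x.1 := rfl

/-- The inclusion of nested subcomplexes commutes with the inclusions into `K`. [folklore] -/
@[reassoc (attr := simp)]
lemma incl_ι {S T : Subcomplex K} (h : S ≤ T) : incl h ≫ T.ι = S.ι := rfl

/-- Inclusions of nested subcomplexes compose. [folklore] -/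
@[reassoc]
lemma incl_comp_incl {S T U : Subcomplex K} (h : S ≤ T) (h' : T ≤ U) :
    incl h ≫ incl h' = incl (h.trans h') := by
  ext i x
  rfl

/-- The inclusion of nested subcomplexes is injective in each degree. [folklore] -/
lemma incl_f_injective {S T : Subcomplex K} (h : S ≤ T) (i : β) :
    Function.Injective ((incl h).f i) := by
  intro x y hxy
  have h' := congrArg Subtype.val hxy
  exact Subtype.ext h'

/-- The inclusion `⊤ ↪ K` of the top subcomplex is an isomorphism. [folklore] -/
instance isIso_ι_top : IsIso (⊤ : Subcomplex K).ι := by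
  haveI : ∀ i, IsIso ((⊤ : Subcomplex K).ι.f i) := fun i => by
    rw [ConcreteCategory.isIso_iff_bijective]
    exact ⟨Subtype.val_injective, fun y => ⟨⟨y, trivial⟩, rfl⟩⟩
  exact HomologicalComplex.Hom.isIso_of_components _

/-! #### The quotient complex -/

/-- The quotient complex `K / S` (Hatcher 2002, §2.1: `C(X, A) = C(X)/C(A)`). [folklore] -/
def quotient (S : Subcomplex K) : HomologicalComplex (ModuleCat.{w} R) c where
  X i := ModuleCat.of R (K.X i ⧸ S i)
  d i j := ModuleCat.ofHom (Submodule.mapQ (S i) (S j) (K.d i j).hom (fun _ hx => S.d_mem hx))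
  shape i j hij := by
    ext x
    change Submodule.Quotient.mk (p := S j) (K.d i j x) = 0
    rw [K.shape i j hij]
    rfl
  d_comp_d' i j k _ _ := by
    ext x
    change Submodule.Quotient.mk (p := S k) (K.d j k (K.d i j x)) = 0
    rw [← ModuleCat.comp_apply, K.d_comp_d]
    rfl

/-- The projection `K ⟶ K / S` (Hatcher 2002, §2.1, the map `j`). [folklore] -/
def π (S : Subcomplex K) : K ⟶ S.quotient where
  f i := ModuleCat.ofHom (S i).mkQ
  comm' _ _ _ := rfl

/-- `π` is the quotient map `Submodule.mkQ` in each degree. [folklore] -/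
lemma π_f_apply (S : Subcomplex K) (i : β) (x : K.X i) :
    S.π.f i x = Submodule.Quotient.mk (p := S i) x := rfl

/-- The differential of `K/S` is induced by that of `K`. [folklore] -/
lemma quotient_d_π_f (S : Subcomplex K) (i j : β) (x : K.X i) :
    S.quotient.d i j (S.π.f i x) = S.π.f j (K.d i j x) := rfl

/-- `π` is surjective in each degree. [folklore] -/
lemma π_f_surjective (S : Subcomplex K) (i : β) : Function.Surjective (S.π.f i) :=
  Submodule.mkQ_surjective _

/-- `π x = 0` iff `x ∈ S`. [folklore] -/
lemma π_f_eq_zero_iff (S : Subcomplex K) (i : β) (x : K.X i) : S.π.f i x = 0 ↔ x ∈ S i :=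
  Submodule.Quotient.mk_eq_zero _

/-- `π x = π y` iff `x - y ∈ S`. [folklore] -/
lemma π_f_eq_π_f_iff (S : Subcomplex K) (i : β) (x y : K.X i) :
    S.π.f i x = S.π.f i y ↔ x - y ∈ S i :=
  Submodule.Quotient.eq _

/-- The projection onto a quotient complex is an epimorphism of complexes. [folklore] -/
instance (S : Subcomplex K) : Epi S.π :=
  HomologicalComplex.epi_of_epi_f _ (fun i => (ModuleCat.epi_iff_surjective _).mpr
    (S.π_f_surjective i))

/-- `ι ≫ π = 0`: the subcomplex dies in the quotient (Hatcher 2002, §2.1). [folklore] -/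
@[reassoc (attr := simp)]
lemma ι_π (S : Subcomplex K) : S.ι ≫ S.π = 0 := by
  ext i x
  exact (Submodule.Quotient.mk_eq_zero _).mpr x.2

/-- The chain map between quotient complexes induced by a chain map `f : K ⟶ L` with `f(S) ⊆ T`
(Hatcher 2002, §2.1, maps of pairs). [folklore] -/
def quotMap (f : K ⟶ L) (S : Subcomplex K) (T : Subcomplex L) (hf : S ≤ T.comap f) :
    S.quotient ⟶ T.quotient where
  f i := ModuleCat.ofHom (Submodule.mapQ (S i) (T i) (f.f i).hom (hf i))
  comm' i j _ := by
    ext x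
    obtain ⟨x, rfl⟩ := S.π_f_surjective i x
    change Submodule.Quotient.mk (p := T j) (L.d i j (f.f i x)) =
      Submodule.Quotient.mk (p := T j) (f.f j (K.d i j x))
    rw [← ModuleCat.comp_apply, f.comm, ModuleCat.comp_apply]

/-- The induced map of quotients on representatives. [folklore] -/
lemma quotMap_f_π_f (f : K ⟶ L) (S : Subcomplex K) (T : Subcomplex L) (hf : S ≤ T.comap f)
    (i : β) (x : K.X i) : (quotMap f S T hf).f i (S.π.f i x) = T.π.f i (f.f i x) := rfl

/-- `π ≫ quotMap f = f ≫ π`. [folklore] -/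
@[reassoc (attr := simp)]
lemma π_quotMap (f : K ⟶ L) (S : Subcomplex K) (T : Subcomplex L) (hf : S ≤ T.comap f) :
    S.π ≫ quotMap f S T hf = f ≫ T.π := rfl

/-- The map of quotients induced by the identity is the identity. [folklore] -/
lemma quotMap_id (S : Subcomplex K) (h : S ≤ S.comap (𝟙 K)) : quotMap (𝟙 K) S S h = 𝟙 _ := by
  ext i x
  obtain ⟨x, rfl⟩ := S.π_f_surjective i x
  rfl

/-- The map of quotients induced by a composite is the composite. [folklore] -/
lemma quotMap_comp (f : K ⟶ L) (g : L ⟶ N) (S : Subcomplex K) (T : Subcomplex L)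
    (U : Subcomplex N) (hf : S ≤ T.comap f) (hg : T ≤ U.comap g) (hfg : S ≤ U.comap (f ≫ g)) :
    quotMap (f ≫ g) S U hfg = quotMap f S T hf ≫ quotMap g T U hg := by
  ext i x
  obtain ⟨x, rfl⟩ := S.π_f_surjective i x
  rfl

/-- The induced map of quotients only depends on the chain map. [folklore] -/
lemma quotMap_congr {f g : K ⟶ L} (h : f = g) (S : Subcomplex K) (T : Subcomplex L)
    (hf : S ≤ T.comap f) (hg : S ≤ T.comap g) : quotMap f S T hf = quotMap g S T hg := by
  subst h
  rfl

/-- The map of quotients `K/S ⟶ K/T` for nested subcomplexes `S ≤ T` (Hatcher 2002, §2.1, e.g.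
`C(X, A) → C(X, B)` for `A ⊆ B`). [folklore] -/
def quotientMap {S T : Subcomplex K} (h : S ≤ T) : S.quotient ⟶ T.quotient :=
  quotMap (𝟙 K) S T h

/-- `K/S ⟶ K/T` on representatives. [folklore] -/
lemma quotientMap_f_π_f {S T : Subcomplex K} (h : S ≤ T) (i : β) (x : K.X i) :
    (quotientMap h).f i (S.π.f i x) = T.π.f i x := rfl

/-- `π_S ≫ (K/S ⟶ K/T) = π_T`. [folklore] -/
@[reassoc (attr := simp)]
lemma π_quotientMap {S T : Subcomplex K} (h : S ≤ T) : S.π ≫ quotientMap h = T.π := rfl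

/-- `K/S ⟶ K/T` is surjective in each degree. [folklore] -/
lemma quotientMap_f_surjective {S T : Subcomplex K} (h : S ≤ T) (i : β) :
    Function.Surjective ((quotientMap h).f i) := by
  intro y
  obtain ⟨x, rfl⟩ := T.π_f_surjective i y
  exact ⟨S.π.f i x, rfl⟩

/-- The maps `K/S ⟶ K/T ⟶ K/U` compose. [folklore] -/
@[reassoc]
lemma quotientMap_comp_quotientMap {S T U : Subcomplex K} (h : S ≤ T) (h' : T ≤ U) :
    quotientMap h ≫ quotientMap h' = quotientMap (h.trans h') := by
  ext i x
  obtain ⟨x, rfl⟩ := S.π_f_surjective i x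
  rfl

/-- `K/S ⟶ K/S' ⟶ L/T` is the map `K/S ⟶ L/T`. [folklore] -/
@[reassoc]
lemma quotientMap_comp_quotMap (f : K ⟶ L) {S S' : Subcomplex K} (T : Subcomplex L)
    (h : S ≤ S') (hf : S' ≤ T.comap f) :
    quotientMap h ≫ quotMap f S' T hf = quotMap f S T (h.trans hf) := by
  ext i x
  obtain ⟨x, rfl⟩ := S.π_f_surjective i x
  rfl

/-- `K/S ⟶ L/T ⟶ L/T'` is the map `K/S ⟶ L/T'`. [folklore] -/
@[reassoc]
lemma quotMap_comp_quotientMap (f : K ⟶ L) (S : Subcomplex K) {T T' : Subcomplex L}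
    (hf : S ≤ T.comap f) (h : T ≤ T') :
    quotMap f S T hf ≫ quotientMap h = quotMap f S T' (fun i _ hx => h i (hf i hx)) := by
  ext i x
  obtain ⟨x, rfl⟩ := S.π_f_surjective i x
  rfl

/-- A quotient map along an isomorphism of complexes matching the subcomplexes is an
isomorphism. [folklore] -/
lemma isIso_quotMap (f : K ⟶ L) [IsIso f] (S : Subcomplex K) (T : Subcomplex L)
    (h : S = T.comap f) : IsIso (quotMap f S T h.le) := by
  haveI : ∀ i, IsIso ((quotMap f S T h.le).f i) := fun i => by
    rw [ConcreteCategory.isIso_iff_bijective]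
    have hfi : Function.Bijective (f.f i) :=
      (ConcreteCategory.isIso_iff_bijective (f.f i)).mp inferInstance
    constructor
    · intro x y hxy
      obtain ⟨x, rfl⟩ := S.π_f_surjective i x
      obtain ⟨y, rfl⟩ := S.π_f_surjective i y
      rw [π_f_eq_π_f_iff, h, mem_comap, map_sub]
      exact (T.π_f_eq_π_f_iff i _ _).mp hxy
    · intro y
      obtain ⟨y, rfl⟩ := T.π_f_surjective i y
      obtain ⟨x, rfl⟩ := hfi.2 y
      exact ⟨S.π.f i x, rfl⟩
  exact HomologicalComplex.Hom.isIso_of_components _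

/-! #### The short exact sequence of a subcomplex -/

/-- The short complex `S ⟶ K ⟶ K/S` (Hatcher 2002, §2.1, display before Thm. 2.13). [folklore] -/
def shortComplex (S : Subcomplex K) : ShortComplex (HomologicalComplex (ModuleCat.{w} R) c) :=
  ShortComplex.mk S.ι S.π S.ι_π

/-- `0 ⟶ S ⟶ K ⟶ K/S ⟶ 0` is short exact (Hatcher 2002, §2.1). [folklore] -/
theorem shortExact (S : Subcomplex K) : S.shortComplex.ShortExact := by
  refine HomologicalComplex.shortExact_of_degreewise_shortExact _ (fun i => ?_)
  refine ModuleCat.shortComplex_shortExact _ ?_ (S.ι_f_injective i) (S.π_f_surjective i)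
  change Function.Exact (S.ι.f i) (S.π.f i)
  intro y
  rw [π_f_eq_zero_iff]
  constructor
  · intro hy
    exact ⟨⟨y, hy⟩, rfl⟩
  · rintro ⟨x, rfl⟩
    exact x.2

/-- The morphism of short exact sequences induced by a chain map `f` with `f(S) ⊆ T`
(Hatcher 2002, §2.1, naturality of the long exact sequence). [folklore] -/
def shortComplexMap (f : K ⟶ L) (S : Subcomplex K) (T : Subcomplex L) (hf : S ≤ T.comap f) :
    S.shortComplex ⟶ T.shortComplex where
  τ₁ := subMap f S T hf
  τ₂ := f
  τ₃ := quotMap f S T hf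
  comm₁₂ := rfl
  comm₂₃ := rfl

/-! #### Relative homology classes -/

/-- A chain `x ∈ Kᵢ` with `d x ∈ S` is a relative cycle: its image in `K/S` is a cycle
(Hatcher 2002, §2.1, "relative cycles"). [folklore] -/
lemma d_π_f_eq_zero (S : Subcomplex K) {i : β} (x : K.X i)
    (hx : K.d i (c.next i) x ∈ S (c.next i)) :
    S.quotient.d i (c.next i) (S.π.f i x) = 0 :=
  (Submodule.Quotient.mk_eq_zero _).mpr hx

/-- The relative homology class `[x] ∈ Hᵢ(K/S)` of a relative cycle `x` (`d x ∈ S`)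
(Hatcher 2002, §2.1). [folklore] -/
def relCls (S : Subcomplex K) {i : β} (x : K.X i) (hx : K.d i (c.next i) x ∈ S (c.next i)) :
    S.quotient.homology i :=
  homologyCls (S.π.f i x) (S.d_π_f_eq_zero x hx)

/-- Every relative homology class is represented by a relative cycle (Hatcher 2002, §2.1). [folklore] -/
lemma relCls_surjective (S : Subcomplex K) {i : β} (a : S.quotient.homology i) :
    ∃ (x : K.X i) (hx : K.d i (c.next i) x ∈ S (c.next i)), S.relCls x hx = a := by
  obtain ⟨z, hz, rfl⟩ := homologyCls_surjective a
  obtain ⟨x, rfl⟩ := S.π_f_surjective i z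
  exact ⟨x, (S.π_f_eq_zero_iff _ _).mp hz, rfl⟩

/-- A relative class `[x]` vanishes iff `x` is a boundary modulo `S` (Hatcher 2002, §2.1). [folklore] -/
lemma relCls_eq_zero_iff (S : Subcomplex K) {i : β} (x : K.X i)
    (hx : K.d i (c.next i) x ∈ S (c.next i)) :
    S.relCls x hx = 0 ↔ ∃ w : K.X (c.prev i), K.d (c.prev i) i w - x ∈ S i := by
  rw [relCls, homologyCls_eq_zero_iff]
  constructor
  · rintro ⟨w, hw⟩
    obtain ⟨w, rfl⟩ := S.π_f_surjective _ w
    exact ⟨w, (S.π_f_eq_π_f_iff i _ _).mp hw⟩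
  · rintro ⟨w, hw⟩
    exact ⟨S.π.f _ w, (S.π_f_eq_π_f_iff i _ _).mpr hw⟩

/-- Relative classes are compatible with subtraction. [folklore] -/
lemma relCls_sub (S : Subcomplex K) {i : β} (x y : K.X i)
    (hx : K.d i (c.next i) x ∈ S (c.next i)) (hy : K.d i (c.next i) y ∈ S (c.next i))
    (hxy : K.d i (c.next i) (x - y) ∈ S (c.next i)) :
    S.relCls (x - y) hxy = S.relCls x hx - S.relCls y hy := by
  have h3 : S.quotient.d i (c.next i) (S.π.f i x - S.π.f i y) = 0 := by
    rw [map_sub, S.d_π_f_eq_zero x hx, S.d_π_f_eq_zero y hy, sub_zero]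
  have e : S.π.f i (x - y) = S.π.f i x - S.π.f i y := map_sub _ x y
  unfold relCls
  exact (homologyCls_congr e _ h3).trans
    (homologyCls_sub (S.π.f i x) (S.π.f i y) (S.d_π_f_eq_zero x hx) (S.d_π_f_eq_zero y hy) h3)

/-- Two relative cycles have the same class iff they differ by a boundary modulo `S`. [folklore] -/
lemma relCls_eq_relCls_iff (S : Subcomplex K) {i : β} (x y : K.X i)
    (hx : K.d i (c.next i) x ∈ S (c.next i)) (hy : K.d i (c.next i) y ∈ S (c.next i)) :
    S.relCls x hx = S.relCls y hy ↔
      ∃ w : K.X (c.prev i), K.d (c.prev i) i w - (x - y) ∈ S i := by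
  have hxy : K.d i (c.next i) (x - y) ∈ S (c.next i) := by
    rw [map_sub]; exact Submodule.sub_mem _ hx hy
  rw [← sub_eq_zero, ← S.relCls_sub x y hx hy hxy, relCls_eq_zero_iff]

/-- The class of an absolute cycle in `Hᵢ(K/S)` is the image of its class under `π`. [folklore] -/
lemma homologyMap_π_homologyCls (S : Subcomplex K) {i : β} (x : K.X i)
    (hx : K.d i (c.next i) x = 0) (hx' : K.d i (c.next i) x ∈ S (c.next i)) :
    HomologicalComplex.homologyMap S.π i (homologyCls x hx) = S.relCls x hx' :=
  homologyMap_homologyCls S.π x hx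

/-- A chain map of pairs sends relative cycles to relative cycles. [folklore] -/
lemma d_f_mem (f : K ⟶ L) (S : Subcomplex K) (T : Subcomplex L) (hf : S ≤ T.comap f) {i : β}
    (x : K.X i) (hx : K.d i (c.next i) x ∈ S (c.next i)) :
    L.d i (c.next i) (f.f i x) ∈ T (c.next i) := by
  rw [← ModuleCat.comp_apply, f.comm, ModuleCat.comp_apply]
  exact hf _ hx

/-- Naturality of relative classes under maps of pairs (Hatcher 2002, §2.1). [folklore] -/
lemma homologyMap_quotMap_relCls (f : K ⟶ L) (S : Subcomplex K) (T : Subcomplex L)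
    (hf : S ≤ T.comap f) {i : β} (x : K.X i) (hx : K.d i (c.next i) x ∈ S (c.next i)) :
    HomologicalComplex.homologyMap (quotMap f S T hf) i (S.relCls x hx) =
      T.relCls (f.f i x) (d_f_mem f S T hf x hx) := by
  rw [relCls, homologyMap_homologyCls]
  rfl

/-- If a class of `Hᵢ(K/S)` is represented by `x` with `d x ∈ S'` for a smaller subcomplex
`S' ≤ S`, it is the image of the class of `x` in `Hᵢ(K/S')` (Hatcher 2002, proof of Lemma 3.27,
step (4)). [folklore] -/
lemma homologyMap_quotientMap_relCls {S' S : Subcomplex K} (h : S' ≤ S) {i : β} (x : K.X i)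
    (hx : K.d i (c.next i) x ∈ S' (c.next i)) :
    HomologicalComplex.homologyMap (quotientMap h) i (S'.relCls x hx) = S.relCls x (h _ hx) :=
  homologyMap_quotMap_relCls _ _ _ _ _ _

/-! #### Excision algebra: `T/(S ⊓ T) ≅ (S ⊔ T)/S` and quotients by quasi-isomorphic subcomplexes -/

/-- For `S ≤ U`, the co-restriction `(S viewed inside U) ⟶ S` is an isomorphism of complexes. [folklore] -/
lemma isIso_subMap_comap_ι {S U : Subcomplex K} (hSU : S ≤ U) :
    IsIso (subMap U.ι (S.comap U.ι) S le_rfl) := by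
  refine S.isIso_lift _ _ (fun i x y hxy => ?_) (fun i y hy => ?_)
  · exact (S.comap U.ι).ι_f_injective i (U.ι_f_injective i hxy)
  · exact ⟨⟨⟨y, hSU i hy⟩, hy⟩, rfl⟩

/-- **Quotients by quasi-isomorphic subcomplexes.** If `S ≤ U ≤ K` and the inclusion `U ↪ K`
induces an isomorphism on `Hᵢ` and monomorphisms on `Hⱼ` for `c.Rel i j`, then
`U/S ⟶ K/S` induces an isomorphism on `Hᵢ` (five lemma on the long exact sequences;
Hatcher 2002, proof of Prop. 2.21/Thm. 2.20: `C^𝒰(X)/C(A) → C(X)/C(A)`). [folklore] -/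
theorem isIso_homologyMap_quotMap_ι {S U : Subcomplex K} (hSU : S ≤ U) (i : β)
    (h₂ : IsIso (HomologicalComplex.homologyMap U.ι i))
    (h₄ : ∀ j, c.Rel i j → Mono (HomologicalComplex.homologyMap U.ι j)) :
    IsIso (HomologicalComplex.homologyMap (quotMap U.ι (S.comap U.ι) S le_rfl) i) := by
  haveI : IsIso (shortComplexMap U.ι (S.comap U.ι) S le_rfl).τ₁ := isIso_subMap_comap_ι hSU
  haveI : ∀ j, IsIso (HomologicalComplex.homologyMap
      (shortComplexMap U.ι (S.comap U.ι) S le_rfl).τ₁ j) := fun j =>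
    Functor.map_isIso (HomologicalComplex.homologyFunctor _ c j) _
  exact HomologicalComplex.HomologySequence.isIso_homologyMap_τ₃
    (shortComplexMap U.ι (S.comap U.ι) S le_rfl) (shortExact _) (shortExact _) i
    inferInstance h₂ (fun j _ => inferInstance) h₄

/-- The second-isomorphism map `T/(S ⊓ T) ⟶ (S ⊔ T)/S` (with `S ⊓ T` viewed inside `T` and `S`
inside `S ⊔ T`) (Hatcher 2002, proof of Thm. 2.20: `C(B)/C(A ∩ B) → C(A + B)/C(A)`, "an obvious
isomorphism"). [folklore] -/
def infQuotToSupQuot (S T : Subcomplex K) :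
    (S.comap T.ι).quotient ⟶ (S.comap (S ⊔ T).ι).quotient :=
  quotMap (incl (le_sup_right : T ≤ S ⊔ T)) (S.comap T.ι) (S.comap (S ⊔ T).ι) (fun _ _ hx => hx)

/-- `T/(S ⊓ T) ⟶ (S ⊔ T)/S ⟶ K/S` is the map `T/(S ⊓ T) ⟶ K/S`. [folklore] -/
@[reassoc]
lemma infQuotToSupQuot_comp (S T : Subcomplex K) :
    infQuotToSupQuot S T ≫ quotMap (S ⊔ T).ι (S.comap (S ⊔ T).ι) S le_rfl =
      quotMap T.ι (S.comap T.ι) S le_rfl := by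
  rw [infQuotToSupQuot, ← quotMap_comp]
  rfl

/-- `T/(S ⊓ T) ⟶ (S ⊔ T)/S` is an isomorphism of complexes (second isomorphism theorem)
(Hatcher 2002, proof of Thm. 2.20). [folklore] -/
instance isIso_infQuotToSupQuot (S T : Subcomplex K) : IsIso (infQuotToSupQuot S T) := by
  haveI : ∀ i, IsIso ((infQuotToSupQuot S T).f i) := fun i => by
    rw [ConcreteCategory.isIso_iff_bijective]
    constructor
    · intro x y hxy
      obtain ⟨x, rfl⟩ := (S.comap T.ι).π_f_surjective i x
      obtain ⟨y, rfl⟩ := (S.comap T.ι).π_f_surjective i y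
      rw [π_f_eq_π_f_iff, mem_comap, map_sub]
      have h := ((S.comap (S ⊔ T).ι).π_f_eq_π_f_iff i _ _).mp hxy
      rw [mem_comap, map_sub] at h
      exact h
    · intro z
      obtain ⟨z, rfl⟩ := (S.comap (S ⊔ T).ι).π_f_surjective i z
      obtain ⟨s, hs, t, ht, hst⟩ := Submodule.mem_sup.mp z.2
      refine ⟨(S.comap T.ι).π.f i ⟨t, ht⟩, ?_⟩
      change (S.comap (S ⊔ T).ι).π.f i _ = _
      rw [π_f_eq_π_f_iff, mem_comap, map_sub]
      change t - z.1 ∈ S i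
      rw [← hst, sub_add_cancel_right]
      exact S i |>.neg_mem hs
  exact HomologicalComplex.Hom.isIso_of_components _

/-- **Excision, algebraic form.** If `S ⊔ T ↪ K` induces an isomorphism on `Hᵢ` and monomorphisms
on `Hⱼ` (`c.Rel i j`), then `T/(S ⊓ T) ⟶ K/S` induces an isomorphism on `Hᵢ`
(Hatcher 2002, proof of Thm. 2.20). [folklore] -/
theorem isIso_homologyMap_quotMap_of_sup (S T : Subcomplex K) (i : β)
    (h₂ : IsIso (HomologicalComplex.homologyMap (S ⊔ T).ι i))
    (h₄ : ∀ j, c.Rel i j → Mono (HomologicalComplex.homologyMap (S ⊔ T).ι j)) :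
    IsIso (HomologicalComplex.homologyMap (quotMap T.ι (S.comap T.ι) S le_rfl) i) := by
  rw [← infQuotToSupQuot_comp, HomologicalComplex.homologyMap_comp]
  haveI := isIso_homologyMap_quotMap_ι (le_sup_left : S ≤ S ⊔ T) i h₂ h₄
  infer_instance

/-! #### The Mayer–Vietoris short exact sequences -/

section MayerVietoris

variable (S T : Subcomplex K)

/-- The map `S ⊓ T ⟶ S ⊞ T`, `x ↦ (x, x)` (Hatcher 2002, §2.2, p. 150). [folklore] -/
abbrev mvSubF : (S ⊓ T).toComplex ⟶ S.toComplex ⊞ T.toComplex :=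
  biprod.lift (incl (inf_le_left : S ⊓ T ≤ S)) (incl (inf_le_right : S ⊓ T ≤ T))

/-- The map `S ⊞ T ⟶ S ⊔ T`, `(y, z) ↦ y - z` (Hatcher 2002, §2.2, p. 150). [folklore] -/
abbrev mvSubG : S.toComplex ⊞ T.toComplex ⟶ (S ⊔ T).toComplex :=
  biprod.desc (incl (le_sup_left : S ≤ S ⊔ T)) (-incl (le_sup_right : T ≤ S ⊔ T))

/-- `(x, x) ↦ x - x = 0`: the Mayer–Vietoris short complex of subcomplexes is a complex (Hatcher 2002, §2.2). [folklore] -/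
@[reassoc]
lemma mvSubF_comp_mvSubG : mvSubF S T ≫ mvSubG S T = 0 := by
  rw [biprod.lift_desc, Preadditive.comp_neg, incl_comp_incl, incl_comp_incl]
  exact add_neg_cancel _

/-- The short complex `S ⊓ T ⟶ S ⊞ T ⟶ S ⊔ T`, `x ↦ (x, x)`, `(y, z) ↦ y - z`
(Hatcher 2002, §2.2, p. 150: `0 → C(A ∩ B) → C(A) ⊕ C(B) → C(A + B) → 0`). [folklore] -/
def mvSub : ShortComplex (HomologicalComplex (ModuleCat.{w} R) c) :=
  ShortComplex.mk (mvSubF S T) (mvSubG S T) (mvSubF_comp_mvSubG S T)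

/-- The first map of `mvSub`. [folklore] -/
lemma mvSub_f : (mvSub S T).f = mvSubF S T := rfl

/-- The second map of `mvSub`. [folklore] -/
lemma mvSub_g : (mvSub S T).g = mvSubG S T := rfl

/-- `mvSubG (y, 0) = y`. [folklore] -/
lemma mvSubG_inl (i : β) (a : S.toComplex.X i) :
    (mvSubG S T).f i ((biprod.inl : _ ⟶ S.toComplex ⊞ T.toComplex).f i a) =
      (incl (le_sup_left : S ≤ S ⊔ T)).f i a := by
  rw [← ModuleCat.comp_apply, ← HomologicalComplex.comp_f, biprod.inl_desc]

/-- `mvSubG (0, z) = -z`. [folklore] -/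
lemma mvSubG_inr (i : β) (b : T.toComplex.X i) :
    (mvSubG S T).f i ((biprod.inr : _ ⟶ S.toComplex ⊞ T.toComplex).f i b) =
      -(incl (le_sup_right : T ≤ S ⊔ T)).f i b := by
  rw [← ModuleCat.comp_apply, ← HomologicalComplex.comp_f, biprod.inr_desc,
    HomologicalComplex.neg_f_apply]
  rfl

/-- `mvSubF x = (x, x)`. [folklore] -/
lemma mvSubF_apply (i : β) (x : (S ⊓ T).toComplex.X i) :
    (mvSubF S T).f i x =
      (biprod.inl : _ ⟶ S.toComplex ⊞ T.toComplex).f i ((incl (inf_le_left : S ⊓ T ≤ S)).f i x) +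
      (biprod.inr : _ ⟶ S.toComplex ⊞ T.toComplex).f i ((incl (inf_le_right : S ⊓ T ≤ T)).f i x) := by
  change (biprod.lift _ _ : (S ⊓ T).toComplex ⟶ S.toComplex ⊞ T.toComplex).f i x = _
  rw [biprod.lift_eq, HomologicalComplex.add_f_apply, HomologicalComplex.comp_f,
    HomologicalComplex.comp_f]
  rfl

/-- `mvSubF` is injective in each degree. [folklore] -/
lemma mvSubF_injective (i : β) : Function.Injective ((mvSubF S T).f i) := by
  intro x y hxy
  have h := congrArg ((biprod.fst : S.toComplex ⊞ T.toComplex ⟶ _).f i) hxy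
  rw [← ModuleCat.comp_apply, ← ModuleCat.comp_apply, ← HomologicalComplex.comp_f,
    biprod.lift_fst] at h
  exact incl_f_injective _ i h

/-- `mvSubG` is surjective in each degree (`S ⊔ T` is the sum). [folklore] -/
lemma mvSubG_surjective (i : β) : Function.Surjective ((mvSubG S T).f i) := by
  intro y
  obtain ⟨s, hs, t, ht, hst⟩ := Submodule.mem_sup.mp y.2
  refine ⟨(biprod.inl : _ ⟶ S.toComplex ⊞ T.toComplex).f i (⟨s, hs⟩ : S.toComplex.X i) -
    (biprod.inr : _ ⟶ S.toComplex ⊞ T.toComplex).f i (⟨t, ht⟩ : T.toComplex.X i), ?_⟩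
  rw [map_sub, mvSubG_inl, mvSubG_inr, sub_neg_eq_add]
  apply Subtype.ext
  exact hst

/-- Exactness of `S ⊓ T ⟶ S ⊞ T ⟶ S ⊔ T` in each degree (Hatcher 2002, §2.2, p. 150). [folklore] -/
lemma mvSub_exact_aux (i : β) : Function.Exact ((mvSubF S T).f i) ((mvSubG S T).f i) := by
  intro y
  constructor
  · intro hy
    set a := (biprod.fst : S.toComplex ⊞ T.toComplex ⟶ _).f i y with ha
    set b := (biprod.snd : S.toComplex ⊞ T.toComplex ⟶ _).f i y with hb
    have htot : (biprod.inl : _ ⟶ S.toComplex ⊞ T.toComplex).f i a +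
        (biprod.inr : _ ⟶ S.toComplex ⊞ T.toComplex).f i b = y := biprod_decomp i y
    have hab : a.1 = b.1 := by
      rw [← htot, map_add, mvSubG_inl, mvSubG_inr, ← sub_eq_add_neg, sub_eq_zero] at hy
      exact congrArg Subtype.val hy
    refine ⟨(⟨a.1, a.2, hab ▸ b.2⟩ : (S ⊓ T).toComplex.X i), ?_⟩
    rw [mvSubF_apply, ← htot]
    congr 2
    exact Subtype.ext hab
  · rintro ⟨x, rfl⟩
    rw [← ModuleCat.comp_apply, ← HomologicalComplex.comp_f, mvSubF_comp_mvSubG]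
    rfl

/-- `0 → S ⊓ T → S ⊞ T → S ⊔ T → 0` is short exact (Hatcher 2002, §2.2, p. 150). [folklore] -/
theorem mvSub_shortExact : (mvSub S T).ShortExact := by
  refine HomologicalComplex.shortExact_of_degreewise_shortExact _ (fun i => ?_)
  exact ModuleCat.shortComplex_shortExact _ (mvSub_exact_aux S T i) (mvSubF_injective S T i)
    (mvSubG_surjective S T i)

/-- The map `K/(S ⊓ T) ⟶ K/S ⊞ K/T`, `x ↦ (x, x)` (Hatcher 2002, §2.2, p. 152). [folklore] -/
abbrev mvQuotF : (S ⊓ T).quotient ⟶ S.quotient ⊞ T.quotient :=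
  biprod.lift (quotientMap (inf_le_left : S ⊓ T ≤ S)) (quotientMap (inf_le_right : S ⊓ T ≤ T))

/-- The map `K/S ⊞ K/T ⟶ K/(S ⊔ T)`, `(y, z) ↦ y - z` (Hatcher 2002, §2.2, p. 152). [folklore] -/
abbrev mvQuotG : S.quotient ⊞ T.quotient ⟶ (S ⊔ T).quotient :=
  biprod.desc (quotientMap (le_sup_left : S ≤ S ⊔ T)) (-quotientMap (le_sup_right : T ≤ S ⊔ T))

/-- The relative Mayer–Vietoris short complex is a complex (Hatcher 2002, §2.2, p. 152). [folklore] -/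
@[reassoc]
lemma mvQuotF_comp_mvQuotG : mvQuotF S T ≫ mvQuotG S T = 0 := by
  rw [biprod.lift_desc, Preadditive.comp_neg, quotientMap_comp_quotientMap,
    quotientMap_comp_quotientMap]
  exact add_neg_cancel _

/-- The short complex `K/(S ⊓ T) ⟶ K/S ⊞ K/T ⟶ K/(S ⊔ T)`, `x ↦ (x, x)`, `(y, z) ↦ y - z`
(Hatcher 2002, §2.2, p. 152, relative Mayer–Vietoris:
`0 → C(X)/C(A ∩ B) → C(X)/C(A) ⊕ C(X)/C(B) → C(X)/C(A + B) → 0`). [folklore] -/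
def mvQuot : ShortComplex (HomologicalComplex (ModuleCat.{w} R) c) :=
  ShortComplex.mk (mvQuotF S T) (mvQuotG S T) (mvQuotF_comp_mvQuotG S T)

/-- The first map of `mvQuot`. [folklore] -/
lemma mvQuot_f : (mvQuot S T).f = mvQuotF S T := rfl

/-- The second map of `mvQuot`. [folklore] -/
lemma mvQuot_g : (mvQuot S T).g = mvQuotG S T := rfl

/-- `mvQuotG (y, 0) = y`. [folklore] -/
lemma mvQuotG_inl (i : β) (a : S.quotient.X i) :
    (mvQuotG S T).f i ((biprod.inl : _ ⟶ S.quotient ⊞ T.quotient).f i a) =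
      (quotientMap (le_sup_left : S ≤ S ⊔ T)).f i a := by
  rw [← ModuleCat.comp_apply, ← HomologicalComplex.comp_f, biprod.inl_desc]

/-- `mvQuotG (0, z) = -z`. [folklore] -/
lemma mvQuotG_inr (i : β) (b : T.quotient.X i) :
    (mvQuotG S T).f i ((biprod.inr : _ ⟶ S.quotient ⊞ T.quotient).f i b) =
      -(quotientMap (le_sup_right : T ≤ S ⊔ T)).f i b := by
  rw [← ModuleCat.comp_apply, ← HomologicalComplex.comp_f, biprod.inr_desc,
    HomologicalComplex.neg_f_apply]
  rfl

/-- `mvQuotF x = (x, x)`. [folklore] -/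
lemma mvQuotF_apply (i : β) (x : (S ⊓ T).quotient.X i) :
    (mvQuotF S T).f i x =
      (biprod.inl : _ ⟶ S.quotient ⊞ T.quotient).f i
          ((quotientMap (inf_le_left : S ⊓ T ≤ S)).f i x) +
        (biprod.inr : _ ⟶ S.quotient ⊞ T.quotient).f i
          ((quotientMap (inf_le_right : S ⊓ T ≤ T)).f i x) := by
  change (biprod.lift _ _ : (S ⊓ T).quotient ⟶ S.quotient ⊞ T.quotient).f i x = _
  rw [biprod.lift_eq, HomologicalComplex.add_f_apply, HomologicalComplex.comp_f,
    HomologicalComplex.comp_f]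
  rfl

/-- `mvQuotF` is injective in each degree (`C(A) ∩ C(B) = C(A ∩ B)`-type statement: `S ⊓ T`). [folklore] -/
lemma mvQuotF_injective (i : β) : Function.Injective ((mvQuotF S T).f i) := by
  intro x y hxy
  have h := congrArg ((biprod.fst : S.quotient ⊞ T.quotient ⟶ _).f i) hxy
  rw [← ModuleCat.comp_apply, ← ModuleCat.comp_apply, ← HomologicalComplex.comp_f,
    biprod.lift_fst] at h
  have h' := congrArg ((biprod.snd : S.quotient ⊞ T.quotient ⟶ _).f i) hxy
  rw [← ModuleCat.comp_apply, ← ModuleCat.comp_apply, ← HomologicalComplex.comp_f,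
    biprod.lift_snd] at h'
  obtain ⟨x, rfl⟩ := (S ⊓ T).π_f_surjective i x
  obtain ⟨y, rfl⟩ := (S ⊓ T).π_f_surjective i y
  rw [quotientMap_f_π_f, quotientMap_f_π_f, π_f_eq_π_f_iff] at h h'
  rw [π_f_eq_π_f_iff]
  exact ⟨h, h'⟩

/-- `mvQuotG` is surjective in each degree. [folklore] -/
lemma mvQuotG_surjective (i : β) : Function.Surjective ((mvQuotG S T).f i) := by
  intro z
  obtain ⟨z, rfl⟩ := (S ⊔ T).π_f_surjective i z
  refine ⟨(biprod.inl : _ ⟶ S.quotient ⊞ T.quotient).f i (S.π.f i z), ?_⟩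
  rw [mvQuotG_inl, quotientMap_f_π_f]

/-- Exactness of `K/(S ⊓ T) ⟶ K/S ⊞ K/T ⟶ K/(S ⊔ T)` in each degree (Hatcher 2002, §2.2, p. 152). [folklore] -/
lemma mvQuot_exact_aux (i : β) : Function.Exact ((mvQuotF S T).f i) ((mvQuotG S T).f i) := by
  intro y
  constructor
  · intro hy
    set a := (biprod.fst : S.quotient ⊞ T.quotient ⟶ _).f i y with ha
    set b := (biprod.snd : S.quotient ⊞ T.quotient ⟶ _).f i y with hb
    have htot : (biprod.inl : _ ⟶ S.quotient ⊞ T.quotient).f i a +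
        (biprod.inr : _ ⟶ S.quotient ⊞ T.quotient).f i b = y := biprod_decomp i y
    obtain ⟨a', ha'⟩ := S.π_f_surjective i a
    obtain ⟨b', hb'⟩ := T.π_f_surjective i b
    have hab : a' - b' ∈ (S ⊔ T) i := by
      rw [← htot, map_add, mvQuotG_inl, mvQuotG_inr, ← ha', ← hb', quotientMap_f_π_f,
        quotientMap_f_π_f, ← sub_eq_add_neg, sub_eq_zero] at hy
      exact ((S ⊔ T).π_f_eq_π_f_iff i _ _).mp hy
    obtain ⟨s, hs, t, ht, hst⟩ := Submodule.mem_sup.mp hab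
    refine ⟨(S ⊓ T).π.f i (a' - s), ?_⟩
    rw [mvQuotF_apply, ← htot, quotientMap_f_π_f, quotientMap_f_π_f]
    have h1 : S.π.f i (a' - s) = a := by
      rw [← ha', π_f_eq_π_f_iff, sub_sub_cancel_left]
      exact (S i).neg_mem hs
    have h2 : T.π.f i (a' - s) = b := by
      rw [← hb', π_f_eq_π_f_iff]
      have e : a' - s - b' = t := by
        rw [sub_right_comm, sub_eq_iff_eq_add, ← hst, add_comm]
      rw [e]
      exact ht
    rw [h1, h2]
  · rintro ⟨x, rfl⟩
    rw [← ModuleCat.comp_apply, ← HomologicalComplex.comp_f, mvQuotF_comp_mvQuotG]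
    rfl

/-- `0 → K/(S ⊓ T) → K/S ⊞ K/T → K/(S ⊔ T) → 0` is short exact (Hatcher 2002, §2.2, p. 152). [folklore] -/
theorem mvQuot_shortExact : (mvQuot S T).ShortExact := by
  refine HomologicalComplex.shortExact_of_degreewise_shortExact _ (fun i => ?_)
  exact ModuleCat.shortComplex_shortExact _ (mvQuot_exact_aux S T i) (mvQuotF_injective S T i)
    (mvQuotG_surjective S T i)

end MayerVietoris

end Subcomplex


end Subcomplexes

end Literature.AlgebraicTopology.SingularHomology

end
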